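import Literature.Analysis.Calculus.HadamardLemma
import HarnessLib

/-!
# Hadamard's lemma of second order in the second factor, with parameters

Topic `Literature/Analysis/Calculus`, continuing `HadamardLemma.lean`.  For `g : E' × E → G`
the **fibrewise second-order Hadamard quotient**
`R g (t, u) = ∫₀¹ (1 - s) • D²g (t, s u) ds : (E' × E) →L[ℝ] (E' × E) →L[ℝ] G`
(the full second derivative integrated along the ray `s ↦ (t, s u)` of the FIBRE `{t} × E`)
is `C^∞` jointly in `(t, u)` (`contDiff_hadamardSnd₂`, differentiation under the integral sign,
`Literature.Analysis.Calculus.contDiff_intervalIntegral`), and its restriction to the fibre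
directions is the Hadamard quotient of the partial map `u ↦ g (t, u)`
(`hadamardSnd₂_apply_inr_inr`, by `∂ᵤ∂ᵤ g (t, w) (a, b) = D²g (t, w) (0, a) (0, b)`,
`fderiv_fderiv_partial_snd`), whence, fibrewise from `HadamardLemma.lean`:

* `eq_add_add_hadamardSnd₂` — `g (t, u) = g (t, 0) + Dg(t, 0) (0, u) + R g (t, u) (0, u) (0, u)`;
* `hadamardSnd₂_symm_inr`, `hadamardSnd₂_apply_zero` (`R g (t, 0) = ½ D²g (t, 0)`);
* `fibreHadamardSnd g (t, u) : E →L E →L G`, the restriction, and `contDiff_fibreHadamardSnd`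
  (`E` finite-dimensional: smoothness is tested on vectors, `contDiff_clm_apply_iff`).

This is the form of Hadamard's lemma used in parametric Morse lemmas (fold normal forms: the
fibre Hessian along a family of critical points).  Standard real analysis (Hirsch,
*Differential Topology* (1976), Ch. 6 §1, proof of Thm. 1.1; Milnor, *Morse theory*, Lemma 2.1),
[folklore].  Everything here is proved.
-/

noncomputable section

-- Instance search through the tower `(E' × E) →L[ℝ] (E' × E) →L[ℝ] G` (normed group, bounded
-- scalar action, completeness) needs one more level of pending depth, as in `HadamardLemma.lean`
-- and Mathlib's operator-norm files.
set_option maxSynthPendingDepth 2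

open Set Function Filter MeasureTheory intervalIntegral
open scoped Topology ContDiff

namespace Literature.Analysis.Calculus

variable {E' E G : Type*} [NormedAddCommGroup E'] [NormedSpace ℝ E'] [NormedAddCommGroup E]
  [NormedSpace ℝ E] [NormedAddCommGroup G] [NormedSpace ℝ G]

/-! ### Partial derivatives in the second factor -/

/-- The partial map `u ↦ g (t, u)` is as smooth as `g`. [folklore] -/
theorem contDiff_partial_snd {g : E' × E → G} {n : WithTop ℕ∞} (hg : ContDiff ℝ n g) (t : E') :
    ContDiff ℝ n fun u => g (t, u) :=
  hg.comp (contDiff_prodMk_right t)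

/-- **First partial derivative in the second factor**: for differentiable `g`,
`D(u ↦ g (t, u))(w) = Dg(t, w) ∘ inr`. [folklore] -/
theorem fderiv_partial_snd {g : E' × E → G} {t : E'} {w : E}
    (hg : DifferentiableAt ℝ g (t, w)) :
    fderiv ℝ (fun u => g (t, u)) w = (fderiv ℝ g (t, w)).comp (ContinuousLinearMap.inr ℝ E' E) :=
  (hg.hasFDerivAt.comp w (hasFDerivAt_prodMk_right t w)).fderiv

/-- **Second partial derivative in the second factor = restricted full second derivative**:
for `C²` `g`, `D(D(u ↦ g (t, u)))(w) a b = D²g (t, w) (0, a) (0, b)`. [folklore] -/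
theorem fderiv_fderiv_partial_snd {g : E' × E → G} {n : WithTop ℕ∞} (hg : ContDiff ℝ n g)
    (hn : 2 ≤ n) (t : E') (w a b : E) :
    fderiv ℝ (fderiv ℝ (fun u => g (t, u))) w a b =
      fderiv ℝ (fderiv ℝ g) (t, w) ((0 : E'), a) ((0 : E'), b) := by
  have h1 : ContDiff ℝ 1 (fderiv ℝ g) := hg.fderiv_right (by simpa [one_add_one_eq_two] using hn)
  have hdiff : ∀ w, DifferentiableAt ℝ g (t, w) := fun w =>
    hg.contDiffAt.differentiableAt (ne_of_gt (lt_of_lt_of_le (by norm_num) hn))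
  -- the partial derivative as a function of `w`, and its derivative in the direction `b`
  have hfun : fderiv ℝ (fun u => g (t, u)) =
      fun w => (fderiv ℝ g (t, w)).comp (ContinuousLinearMap.inr ℝ E' E) :=
    funext fun w => fderiv_partial_snd (hdiff w)
  have hD2 : HasFDerivAt (fderiv ℝ g) (fderiv ℝ (fderiv ℝ g) (t, w)) (t, w) :=
    ((h1.differentiable one_ne_zero) _).hasFDerivAt
  -- `w ↦ Dg(t, w)` has derivative `D²g(t, w) ∘ inr`
  have hcomp : HasFDerivAt (fun w => fderiv ℝ g (t, w))
      ((fderiv ℝ (fderiv ℝ g) (t, w)).comp (ContinuousLinearMap.inr ℝ E' E)) w :=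
    hD2.comp w (hasFDerivAt_prodMk_right t w)
  -- compose with the continuous linear map `L ↦ L ∘ inr`
  set Φ := (ContinuousLinearMap.compL ℝ E (E' × E) G).flip (ContinuousLinearMap.inr ℝ E' E)
    with hΦ
  have hΦapply : ∀ L : (E' × E) →L[ℝ] G, Φ L = L.comp (ContinuousLinearMap.inr ℝ E' E) :=
    fun L => by simp [hΦ]
  have hfun' : fderiv ℝ (fun u => g (t, u)) = fun w => Φ (fderiv ℝ g (t, w)) := by
    rw [hfun]
    funext w
    rw [hΦapply]
  have h : HasFDerivAt (fun w => Φ (fderiv ℝ g (t, w)))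
      (Φ.comp ((fderiv ℝ (fderiv ℝ g) (t, w)).comp (ContinuousLinearMap.inr ℝ E' E))) w :=
    Φ.hasFDerivAt.comp w hcomp
  rw [hfun', h.fderiv]
  simp [hΦapply]

/-! ### The fibrewise second-order Hadamard quotient -/

/-- **The fibrewise second-order Hadamard quotient** of `g : E' × E → G`:
`R g (t, u) = ∫₀¹ (1 - s) • D²g (t, s u) ds`. [folklore] -/
def hadamardSnd₂ (g : E' × E → G) (x : E' × E) : (E' × E) →L[ℝ] (E' × E) →L[ℝ] G :=
  ∫ s in (0 : ℝ)..1, (1 - s) • fderiv ℝ (fderiv ℝ g) (x.1, s • x.2)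

/-- The integrand of `hadamardSnd₂` is continuous in all variables (for `C²` `g`). [folklore] -/
theorem continuous_hadamardSnd₂_integrand {g : E' × E → G} {n : WithTop ℕ∞}
    (hg : ContDiff ℝ n g) (hn : 2 ≤ n) :
    Continuous (uncurry fun (x : E' × E) (s : ℝ) =>
      (1 - s) • fderiv ℝ (fderiv ℝ g) (x.1, s • x.2)) := by
  refine (continuous_const.sub continuous_snd).smul ((continuous_fderiv_fderiv hg hn).comp ?_)
  exact (continuous_fst.comp continuous_fst).prodMk (continuous_snd.smul
    (continuous_snd.comp continuous_fst))

/-- The integrand of `hadamardSnd₂ g x` is interval integrable. [folklore] -/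
theorem intervalIntegrable_hadamardSnd₂_integrand {g : E' × E → G} {n : WithTop ℕ∞}
    (hg : ContDiff ℝ n g) (hn : 2 ≤ n) (x : E' × E) (a b : ℝ) :
    IntervalIntegrable (fun s : ℝ => (1 - s) • fderiv ℝ (fderiv ℝ g) (x.1, s • x.2))
      volume a b :=
  ((continuous_hadamardSnd₂_integrand hg hn).comp (Continuous.prodMk_right x)).intervalIntegrable
    a b

/-- Evaluation of the fibrewise quotient on two vectors commutes with the integral. [folklore] -/
theorem hadamardSnd₂_apply_apply [CompleteSpace G] {g : E' × E → G} {n : WithTop ℕ∞}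
    (hg : ContDiff ℝ n g) (hn : 2 ≤ n) (x : E' × E) (v w : E' × E) :
    hadamardSnd₂ g x v w =
      ∫ s in (0 : ℝ)..1, (1 - s) • fderiv ℝ (fderiv ℝ g) (x.1, s • x.2) v w := by
  have h1 := intervalIntegrable_hadamardSnd₂_integrand hg hn x 0 1
  rw [hadamardSnd₂, ContinuousLinearMap.intervalIntegral_apply h1 v]
  have h2 : IntervalIntegrable
      (fun s : ℝ => ((1 - s) • fderiv ℝ (fderiv ℝ g) (x.1, s • x.2)) v) volume 0 1 :=
    ((ContinuousLinearMap.apply ℝ ((E' × E) →L[ℝ] G) v).continuous.comp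
      ((continuous_hadamardSnd₂_integrand hg hn).comp
        (Continuous.prodMk_right x))).intervalIntegrable 0 1
  rw [ContinuousLinearMap.intervalIntegral_apply h2 w]
  rfl

/-- **On fibre directions the fibrewise quotient is the Hadamard quotient of the partial map**:
`R g (t, u) (0, a) (0, b) = hadamardSnd (g (t, ·)) u a b`. [folklore] -/
theorem hadamardSnd₂_apply_inr_inr [CompleteSpace G] {g : E' × E → G} {n : WithTop ℕ∞}
    (hg : ContDiff ℝ n g) (hn : 2 ≤ n) (t : E') (u a b : E) :
    hadamardSnd₂ g (t, u) ((0 : E'), a) ((0 : E'), b) = hadamardSnd (fun u => g (t, u)) u a b := by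
  rw [hadamardSnd₂_apply_apply hg hn, hadamardSnd_apply_apply (contDiff_partial_snd hg t) hn]
  refine intervalIntegral.integral_congr fun s _ => ?_
  show (1 - s) • fderiv ℝ (fderiv ℝ g) (t, s • u) (0, a) (0, b) =
    (1 - s) • fderiv ℝ (fderiv ℝ (fun u => g (t, u))) (s • u) a b
  rw [fderiv_fderiv_partial_snd hg hn]

/-- **Hadamard's lemma of second order in the second factor**: for `C²` `g`,
`g (t, u) = g (t, 0) + Dg(t, 0) (0, u) + R g (t, u) (0, u) (0, u)`. [folklore] -/
theorem eq_add_add_hadamardSnd₂ [CompleteSpace G] {g : E' × E → G} {n : WithTop ℕ∞}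
    (hg : ContDiff ℝ n g) (hn : 2 ≤ n) (t : E') (u : E) :
    g (t, u) = g (t, 0) + fderiv ℝ g (t, 0) ((0 : E'), u) +
      hadamardSnd₂ g (t, u) ((0 : E'), u) ((0 : E'), u) := by
  have h := eq_add_add_hadamardSnd (contDiff_partial_snd hg t) hn u
  have hd : DifferentiableAt ℝ g (t, 0) :=
    hg.contDiffAt.differentiableAt (ne_of_gt (lt_of_lt_of_le (by norm_num) hn))
  rw [hadamardSnd₂_apply_inr_inr hg hn, fderiv_partial_snd hd] at *
  simpa using h

/-- **At a fibrewise critical point**: if `g (t, 0) = 0` and `Dg(t, 0) (0, ·) = 0` then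
`g (t, u) = R g (t, u) (0, u) (0, u)`. [folklore] -/
theorem eq_hadamardSnd₂_of_isCritical [CompleteSpace G] {g : E' × E → G} {n : WithTop ℕ∞}
    (hg : ContDiff ℝ n g) (hn : 2 ≤ n) {t : E'} (h0 : g (t, 0) = 0)
    (h0' : ∀ u : E, fderiv ℝ g (t, 0) ((0 : E'), u) = 0) (u : E) :
    g (t, u) = hadamardSnd₂ g (t, u) ((0 : E'), u) ((0 : E'), u) := by
  rw [eq_add_add_hadamardSnd₂ hg hn t u, h0, h0' u]
  simp

/-- The fibrewise quotient is symmetric on fibre directions. [folklore] -/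
theorem hadamardSnd₂_symm_inr [CompleteSpace G] {g : E' × E → G} {n : WithTop ℕ∞}
    (hg : ContDiff ℝ n g) (hn : 2 ≤ n) (t : E') (u a b : E) :
    hadamardSnd₂ g (t, u) ((0 : E'), a) ((0 : E'), b) =
      hadamardSnd₂ g (t, u) ((0 : E'), b) ((0 : E'), a) := by
  rw [hadamardSnd₂_apply_inr_inr hg hn, hadamardSnd₂_apply_inr_inr hg hn]
  exact hadamardSnd_symm (contDiff_partial_snd hg t) hn u a b

/-- **Value on the zero section: `R g (t, 0) = ½ D²g (t, 0)`**. [folklore] -/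
theorem hadamardSnd₂_apply_zero [CompleteSpace G] (g : E' × E → G) (t : E') :
    hadamardSnd₂ g (t, 0) = (2⁻¹ : ℝ) • fderiv ℝ (fderiv ℝ g) (t, 0) := by
  have h : ∫ s in (0 : ℝ)..1, (1 - s) = 2⁻¹ := by
    rw [intervalIntegral.integral_sub intervalIntegrable_const
      intervalIntegral.intervalIntegrable_id, intervalIntegral.integral_const, integral_id]
    norm_num
  simp only [hadamardSnd₂, smul_zero]
  rw [intervalIntegral.integral_smul_const, h]

/-- **Joint smoothness of the fibrewise quotient**: if `g` is `C^∞` (finite-dimensional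
`E'`, `E`, complete `G`) then `R g` is `C^∞` on `E' × E` (differentiation under the integral
sign). [folklore] -/
theorem contDiff_hadamardSnd₂ [FiniteDimensional ℝ E'] [FiniteDimensional ℝ E] [CompleteSpace G]
    {g : E' × E → G} (hg : ContDiff ℝ ∞ g) : ContDiff ℝ ∞ (hadamardSnd₂ g) := by
  have h2 : ContDiff ℝ ∞ (fderiv ℝ (fderiv ℝ g)) :=
    (hg.fderiv_right le_rfl).fderiv_right le_rfl
  have hp : ContDiff ℝ ∞ fun p : (E' × E) × ℝ => ((p.1.1, p.2 • p.1.2) : E' × E) :=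
    (contDiff_fst.comp contDiff_fst).prodMk (contDiff_snd.smul (contDiff_snd.comp contDiff_fst))
  have hF : ContDiff ℝ ∞ (uncurry fun (x : E' × E) (s : ℝ) =>
      (1 - s) • fderiv ℝ (fderiv ℝ g) (x.1, s • x.2)) :=
    (contDiff_const.sub contDiff_snd).smul (h2.comp hp)
  have key : ContDiff ℝ ((⊤ : ℕ∞) : WithTop ℕ∞) (hadamardSnd₂ g) :=
    contDiff_intervalIntegral (n := ⊤) (by simpa using hF) 0 1
  simpa using key

/-! ### The fibre form -/

/-- **The fibre Hadamard form** `(a, b) ↦ R g (t, u) (0, a) (0, b)` as a continuous bilinear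
map on `E`. [folklore] -/
def fibreHadamardSnd (g : E' × E → G) (x : E' × E) : E →L[ℝ] E →L[ℝ] G :=
  (hadamardSnd₂ g x).bilinearComp (ContinuousLinearMap.inr ℝ E' E)
    (ContinuousLinearMap.inr ℝ E' E)

/-- `fibreHadamardSnd g x a b = R g x (0, a) (0, b)`. [folklore] -/
@[simp] theorem fibreHadamardSnd_apply (g : E' × E → G) (x : E' × E) (a b : E) :
    fibreHadamardSnd g x a b = hadamardSnd₂ g x ((0 : E'), a) ((0 : E'), b) := by
  simp [fibreHadamardSnd]

/-- **The fibre Hadamard form is `C^∞` in `(t, u)`** (`E` finite-dimensional: smoothness of a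
map into `E →L E →L G` is tested on pairs of vectors). [folklore] -/
theorem contDiff_fibreHadamardSnd [FiniteDimensional ℝ E'] [FiniteDimensional ℝ E]
    [CompleteSpace G] {g : E' × E → G} (hg : ContDiff ℝ ∞ g) :
    ContDiff ℝ ∞ (fibreHadamardSnd g) := by
  refine contDiff_clm_apply_iff.2 fun a => contDiff_clm_apply_iff.2 fun b => ?_
  simp only [fibreHadamardSnd_apply]
  exact ((contDiff_hadamardSnd₂ hg).clm_apply contDiff_const).clm_apply contDiff_const

/-- At a point of the zero section the fibre form is half the fibre Hessian:
`fibreHadamardSnd g (t, 0) a b = ½ D²g (t, 0) (0, a) (0, b)`. [folklore] -/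
theorem fibreHadamardSnd_apply_zero [CompleteSpace G] (g : E' × E → G) (t : E') (a b : E) :
    fibreHadamardSnd g (t, 0) a b =
      (2⁻¹ : ℝ) • fderiv ℝ (fderiv ℝ g) (t, 0) ((0 : E'), a) ((0 : E'), b) := by
  rw [fibreHadamardSnd_apply, hadamardSnd₂_apply_zero]
  rfl

/-- The fibre form is symmetric (for `C²` `g`). [folklore] -/
theorem fibreHadamardSnd_symm [CompleteSpace G] {g : E' × E → G} {n : WithTop ℕ∞}
    (hg : ContDiff ℝ n g) (hn : 2 ≤ n) (t : E') (u a b : E) :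
    fibreHadamardSnd g (t, u) a b = fibreHadamardSnd g (t, u) b a := by
  rw [fibreHadamardSnd_apply, fibreHadamardSnd_apply]
  exact hadamardSnd₂_symm_inr hg hn t u a b

/-- **Hadamard at a family of critical points, fibre form**: if `g (t, 0) = 0` and
`∂ᵤ g (t, 0) = 0` then `g (t, u) = fibreHadamardSnd g (t, u) u u`. [folklore] -/
theorem eq_fibreHadamardSnd_of_isCritical [CompleteSpace G] {g : E' × E → G} {n : WithTop ℕ∞}
    (hg : ContDiff ℝ n g) (hn : 2 ≤ n) {t : E'} (h0 : g (t, 0) = 0)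
    (h0' : ∀ u : E, fderiv ℝ g (t, 0) ((0 : E'), u) = 0) (u : E) :
    g (t, u) = fibreHadamardSnd g (t, u) u u := by
  rw [fibreHadamardSnd_apply]
  exact eq_hadamardSnd₂_of_isCritical hg hn h0 h0' u

end Literature.Analysis.Calculus

end
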